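import Summits.ValiantsHypothesis.ValiantsHypothesis.Theorems.KPlusLogSqLawStaticTridiagonalTopClass

/-!
# Static definite tridiagonal designs of sizes 3 and 4: ALL-DESIGNS upper bounds from the inertia-class laws
# (irreducible `3 × 3`: `Z ≤ 2`; irreducible `4 × 4`: `Z ≤ 4`) — Part 4

HONEST FRAMING.  Helper theorems (`--supports stmt-ValiantsHypothesis-19561 --as helper`; seat val-sym-lift-p2 g9, cell
`pub-symmetroid`, 2026-08-27) on the REAL side of the desk's typed α target (lead R2102/R2114).  The target (`Z ≤ C·m + C₀` for ALL
sizes) is NOT proved here; these are the first two non-trivial sizes, where the two extreme inertia classes exhaust all classes: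
for an IRREDUCIBLE design (no vanishing link coefficient `c_(k,k+1)`) every positive determinant zero of a `3 × 3` design is in the
bottom class and every positive zero of a `4 × 4` design is in the bottom or in the top class, so Part 2's BOTTOM-CLASS LAW
(`card_posRoots_bottomClass_le_two`) and Part 3b's TOP-CLASS LAW (`card_posRoots_topClass_le_two`) give `Z(3) ≤ 2` (the located sharp
value `m − 1`) and `Z(4) ≤ 4` (located sharp value `3`, not claimed) for EVERY irreducible static definite tridiagonal design of
these sizes, with no genericity or separation hypothesis.  Reducible designs split into smaller blocks and are not treated.  Calibration
rows; nothing here bears on `WeakLifting` (stmt-19561) / `TropicalB` (stmt-19771) in their windows, Conjecture B, the Door-A registers,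
`MatrixDescartes` (stmt-ValiantsHypothesis-18050) or VP ≠ VNP.

WHAT IS PROVED.
1. `ctK_consecutive_ne_zero` — for an irreducible design two consecutive continuants (leading principal minors) never vanish together
   at a positive point; `ctK_mul_pos_of_root` — at a positive determinant zero of an irreducible design of size `n + 2` the two
   preceding minors are non-zero and of the same sign (`d_(n+2) Δ_(n+1) = w_(n+1) Δ_n`, `d, w > 0`).
2. **`card_posRoots_three_le_two`** — irreducible `3 × 3`: at most TWO distinct positive determinant zeros (R2102's count).
3. **`card_posRoots_four_le_four`** — irreducible `4 × 4`: at most FOUR distinct positive determinant zeros.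
[folklore: continuants; the class laws are Parts 2 and 3b of this seat.]
-/

set_option linter.dupNamespace false
set_option autoImplicit false

namespace Summit.ValiantsHypothesis.ValiantsHypothesis.Theorems.KPlusLogSqLaw.DefiniteInterpolation

open Summit.ValiantsHypothesis.ValiantsHypothesis.Theorems.ValuativeFlip (ctK ctK_zero ctK_one ctK_add_two)
open Polynomial

/-! ### Small sizes: every positive zero of an IRREDUCIBLE design of size `3` (resp. `4`) lies in the bottom class
(resp. in the bottom or in the top class), so `Z ≤ 2` (resp. `Z ≤ 4`) for all such designs -/

section SmallSizes

variable {m : ℕ} (c : Fin m → Fin m → ℝ) (e : Fin m → Fin m → ℕ)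

/-- For an irreducible design (no vanishing link coefficient) two consecutive continuants never vanish simultaneously at a
positive point (below the size). [folklore: continuant] -/
theorem ctK_consecutive_ne_zero (hc : ∀ i j, c i j = c j i)
    (hirr : ∀ (k : ℕ) (hk : k + 1 < m), c ⟨k, by omega⟩ ⟨k + 1, hk⟩ ≠ 0) {t : ℝ} (ht : 0 < t) :
    ∀ k, k + 1 < m → ¬ (ctK (fun s : ℕ => if h : s < m then c ⟨s, h⟩ ⟨s, h⟩ * t ^ e ⟨s, h⟩ ⟨s, h⟩ else 1)
        (fun s : ℕ => -(if h : s + 1 < m then c ⟨s, by omega⟩ ⟨s + 1, h⟩ * t ^ e ⟨s, by omega⟩ ⟨s + 1, h⟩ else 0))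
        (fun s : ℕ => if h : 1 ≤ s ∧ s < m then c ⟨s, h.2⟩ ⟨s - 1, by omega⟩ * t ^ e ⟨s, h.2⟩ ⟨s - 1, by omega⟩ else 0) k = 0 ∧
      ctK (fun s : ℕ => if h : s < m then c ⟨s, h⟩ ⟨s, h⟩ * t ^ e ⟨s, h⟩ ⟨s, h⟩ else 1)
        (fun s : ℕ => -(if h : s + 1 < m then c ⟨s, by omega⟩ ⟨s + 1, h⟩ * t ^ e ⟨s, by omega⟩ ⟨s + 1, h⟩ else 0))
        (fun s : ℕ => if h : 1 ≤ s ∧ s < m then c ⟨s, h.2⟩ ⟨s - 1, by omega⟩ * t ^ e ⟨s, h.2⟩ ⟨s - 1, by omega⟩ else 0) (k + 1) = 0) := by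
  intro k
  induction k with
  | zero => intro _ h; rw [ctK_zero] at h; exact one_ne_zero h.1
  | succ k ih =>
    intro hk h
    apply ih (by omega)
    refine ⟨?_, h.1⟩
    have hrec := ctK_add_two (fun s : ℕ => if h : s < m then c ⟨s, h⟩ ⟨s, h⟩ * t ^ e ⟨s, h⟩ ⟨s, h⟩ else 1)
      (fun s : ℕ => -(if h : s + 1 < m then c ⟨s, by omega⟩ ⟨s + 1, h⟩ * t ^ e ⟨s, by omega⟩ ⟨s + 1, h⟩ else 0))
      (fun s : ℕ => if h : 1 ≤ s ∧ s < m then c ⟨s, h.2⟩ ⟨s - 1, by omega⟩ * t ^ e ⟨s, h.2⟩ ⟨s - 1, by omega⟩ else 0) k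
    rw [h.2, h.1, mul_zero, zero_add] at hrec
    have hw := linkWeight_eq c e t k
    rw [dif_pos (show k + 1 < m by omega)] at hw
    have hwpos : 0 < -((fun s : ℕ => -(if h : s + 1 < m then c ⟨s, by omega⟩ ⟨s + 1, h⟩ * t ^ e ⟨s, by omega⟩ ⟨s + 1, h⟩ else 0)) k *
        (fun s : ℕ => if h : 1 ≤ s ∧ s < m then c ⟨s, h.2⟩ ⟨s - 1, by omega⟩ * t ^ e ⟨s, h.2⟩ ⟨s - 1, by omega⟩ else 0) (k + 1)) := by
      rw [hw, hc ⟨k + 1, by omega⟩]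
      exact mul_pos (mul_self_pos.mpr (hirr k (by omega))) (pow_pos ht _)
    have hprod : ((fun s : ℕ => -(if h : s + 1 < m then c ⟨s, by omega⟩ ⟨s + 1, h⟩ * t ^ e ⟨s, by omega⟩ ⟨s + 1, h⟩ else 0)) k *
        (fun s : ℕ => if h : 1 ≤ s ∧ s < m then c ⟨s, h.2⟩ ⟨s - 1, by omega⟩ * t ^ e ⟨s, h.2⟩ ⟨s - 1, by omega⟩ else 0) (k + 1)) *
        ctK (fun s : ℕ => if h : s < m then c ⟨s, h⟩ ⟨s, h⟩ * t ^ e ⟨s, h⟩ ⟨s, h⟩ else 1)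
        (fun s : ℕ => -(if h : s + 1 < m then c ⟨s, by omega⟩ ⟨s + 1, h⟩ * t ^ e ⟨s, by omega⟩ ⟨s + 1, h⟩ else 0))
        (fun s : ℕ => if h : 1 ≤ s ∧ s < m then c ⟨s, h.2⟩ ⟨s - 1, by omega⟩ * t ^ e ⟨s, h.2⟩ ⟨s - 1, by omega⟩ else 0) k = 0 := by
      linarith [hrec]
    rcases mul_eq_zero.mp hprod with h0 | h0
    · exfalso; rw [h0, neg_zero] at hwpos; exact lt_irrefl 0 hwpos
    · exact h0

/-- At a positive zero of the determinant of an irreducible design of size `n + 2`, the two preceding continuants are non-zero and of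
the SAME sign (`L K_(n+1) = w K_n` with `L, w > 0`). [this file] -/
theorem ctK_mul_pos_of_root (hc : ∀ i j, c i j = c j i) (hpos : ∀ i, 0 < c i i)
    (hirr : ∀ (k : ℕ) (hk : k + 1 < m), c ⟨k, by omega⟩ ⟨k + 1, hk⟩ ≠ 0) {t : ℝ} (ht : 0 < t) (n : ℕ) (hn : n + 2 = m)
    (hroot : ctK (fun s : ℕ => if h : s < m then c ⟨s, h⟩ ⟨s, h⟩ * t ^ e ⟨s, h⟩ ⟨s, h⟩ else 1)
        (fun s : ℕ => -(if h : s + 1 < m then c ⟨s, by omega⟩ ⟨s + 1, h⟩ * t ^ e ⟨s, by omega⟩ ⟨s + 1, h⟩ else 0))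
        (fun s : ℕ => if h : 1 ≤ s ∧ s < m then c ⟨s, h.2⟩ ⟨s - 1, by omega⟩ * t ^ e ⟨s, h.2⟩ ⟨s - 1, by omega⟩ else 0) (n + 2) = 0) :
    0 < ctK (fun s : ℕ => if h : s < m then c ⟨s, h⟩ ⟨s, h⟩ * t ^ e ⟨s, h⟩ ⟨s, h⟩ else 1)
        (fun s : ℕ => -(if h : s + 1 < m then c ⟨s, by omega⟩ ⟨s + 1, h⟩ * t ^ e ⟨s, by omega⟩ ⟨s + 1, h⟩ else 0))
        (fun s : ℕ => if h : 1 ≤ s ∧ s < m then c ⟨s, h.2⟩ ⟨s - 1, by omega⟩ * t ^ e ⟨s, h.2⟩ ⟨s - 1, by omega⟩ else 0) (n + 1) *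
      ctK (fun s : ℕ => if h : s < m then c ⟨s, h⟩ ⟨s, h⟩ * t ^ e ⟨s, h⟩ ⟨s, h⟩ else 1)
        (fun s : ℕ => -(if h : s + 1 < m then c ⟨s, by omega⟩ ⟨s + 1, h⟩ * t ^ e ⟨s, by omega⟩ ⟨s + 1, h⟩ else 0))
        (fun s : ℕ => if h : 1 ≤ s ∧ s < m then c ⟨s, h.2⟩ ⟨s - 1, by omega⟩ * t ^ e ⟨s, h.2⟩ ⟨s - 1, by omega⟩ else 0) n := by
  have hrec := ctK_add_two (fun s : ℕ => if h : s < m then c ⟨s, h⟩ ⟨s, h⟩ * t ^ e ⟨s, h⟩ ⟨s, h⟩ else 1)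
    (fun s : ℕ => -(if h : s + 1 < m then c ⟨s, by omega⟩ ⟨s + 1, h⟩ * t ^ e ⟨s, by omega⟩ ⟨s + 1, h⟩ else 0))
    (fun s : ℕ => if h : 1 ≤ s ∧ s < m then c ⟨s, h.2⟩ ⟨s - 1, by omega⟩ * t ^ e ⟨s, h.2⟩ ⟨s - 1, by omega⟩ else 0) n
  rw [hroot] at hrec
  have hL := diagSeq_pos c e hpos ht (n + 1)
  have hw := linkWeight_eq c e t n
  rw [dif_pos (show n + 1 < m by omega)] at hw
  have hwpos : 0 < -((fun s : ℕ => -(if h : s + 1 < m then c ⟨s, by omega⟩ ⟨s + 1, h⟩ * t ^ e ⟨s, by omega⟩ ⟨s + 1, h⟩ else 0)) n *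
      (fun s : ℕ => if h : 1 ≤ s ∧ s < m then c ⟨s, h.2⟩ ⟨s - 1, by omega⟩ * t ^ e ⟨s, h.2⟩ ⟨s - 1, by omega⟩ else 0) (n + 1)) := by
    rw [hw, hc ⟨n + 1, by omega⟩]
    exact mul_pos (mul_self_pos.mpr (hirr n (by omega))) (pow_pos ht _)
  have hnz := ctK_consecutive_ne_zero c e hc hirr ht n (by omega)
  set A := ctK (fun s : ℕ => if h : s < m then c ⟨s, h⟩ ⟨s, h⟩ * t ^ e ⟨s, h⟩ ⟨s, h⟩ else 1)
        (fun s : ℕ => -(if h : s + 1 < m then c ⟨s, by omega⟩ ⟨s + 1, h⟩ * t ^ e ⟨s, by omega⟩ ⟨s + 1, h⟩ else 0))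
        (fun s : ℕ => if h : 1 ≤ s ∧ s < m then c ⟨s, h.2⟩ ⟨s - 1, by omega⟩ * t ^ e ⟨s, h.2⟩ ⟨s - 1, by omega⟩ else 0) (n + 1) with hA
  set B := ctK (fun s : ℕ => if h : s < m then c ⟨s, h⟩ ⟨s, h⟩ * t ^ e ⟨s, h⟩ ⟨s, h⟩ else 1)
        (fun s : ℕ => -(if h : s + 1 < m then c ⟨s, by omega⟩ ⟨s + 1, h⟩ * t ^ e ⟨s, by omega⟩ ⟨s + 1, h⟩ else 0))
        (fun s : ℕ => if h : 1 ≤ s ∧ s < m then c ⟨s, h.2⟩ ⟨s - 1, by omega⟩ * t ^ e ⟨s, h.2⟩ ⟨s - 1, by omega⟩ else 0) n with hB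
  set Lv := (fun s : ℕ => if h : s < m then c ⟨s, h⟩ ⟨s, h⟩ * t ^ e ⟨s, h⟩ ⟨s, h⟩ else 1) (n + 1) with hLv
  set W := -((fun s : ℕ => -(if h : s + 1 < m then c ⟨s, by omega⟩ ⟨s + 1, h⟩ * t ^ e ⟨s, by omega⟩ ⟨s + 1, h⟩ else 0)) n *
      (fun s : ℕ => if h : 1 ≤ s ∧ s < m then c ⟨s, h.2⟩ ⟨s - 1, by omega⟩ * t ^ e ⟨s, h.2⟩ ⟨s - 1, by omega⟩ else 0) (n + 1)) with hW
  have key : Lv * A = W * B := by rw [hW]; linarith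
  have hB0 : B ≠ 0 := by
    intro hB0
    have hA0 : A = 0 := by
      have hLA : Lv * A = 0 := by rw [key, hB0, mul_zero]
      rcases mul_eq_zero.mp hLA with h | h
      · exact absurd h hL.ne'
      · exact h
    exact hnz ⟨hB0, hA0⟩
  have hAB : A * B = (W / Lv) * (B * B) := by
    field_simp
    linarith [key]
  rw [hAB]
  exact mul_pos (div_pos hwpos hL) (mul_self_pos.mpr hB0)

/-- **THREE-BY-THREE LAW: an irreducible static definite tridiagonal `3 × 3` design has at most TWO positive determinant zeros**
(the located sharp value `m − 1 = 2`).  Every positive zero lies in the bottom class (`Δ₁ > 0` always, and `d₃ Δ₂ = w₂ Δ₁ > 0` at a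
zero), so the bottom-class law applies. [this file] -/
theorem card_posRoots_three_le_two (c : Fin 3 → Fin 3 → ℝ) (e : Fin 3 → Fin 3 → ℕ) (hc : ∀ i j, c i j = c j i)
    (hband : ∀ i j : Fin 3, (i : ℕ) + 1 < j ∨ (j : ℕ) + 1 < i → c i j = 0) (hpos : ∀ i, 0 < c i i)
    (hirr : ∀ (k : ℕ) (hk : k + 1 < 3), c ⟨k, by omega⟩ ⟨k + 1, hk⟩ ≠ 0) :
    ((Matrix.det (Matrix.of fun i j => C (c i j) * (X : ℝ[X]) ^ e i j)).roots.toFinset.filter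
      (fun t : ℝ => 0 < t)).card ≤ 2 := by
  refine le_trans (Finset.card_le_card ?_) (card_posRoots_bottomClass_le_two c e hc hband hpos)
  intro t ht
  rw [Finset.mem_filter] at ht ⊢
  obtain ⟨hmem, ht0⟩ := ht
  refine ⟨hmem, ht0, ?_⟩
  rw [Multiset.mem_toFinset, Polynomial.mem_roots'] at hmem
  have hroot : ctK (fun s : ℕ => if h : s < 3 then c ⟨s, h⟩ ⟨s, h⟩ * t ^ e ⟨s, h⟩ ⟨s, h⟩ else 1)
        (fun s : ℕ => -(if h : s + 1 < 3 then c ⟨s, by omega⟩ ⟨s + 1, h⟩ * t ^ e ⟨s, by omega⟩ ⟨s + 1, h⟩ else 0))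
        (fun s : ℕ => if h : 1 ≤ s ∧ s < 3 then c ⟨s, h.2⟩ ⟨s - 1, by omega⟩ * t ^ e ⟨s, h.2⟩ ⟨s - 1, by omega⟩ else 0) 3 = 0 := by
    rw [← det_design_eq_ctK c e hband t, ← eval_det_design c e t]; exact hmem.2
  have h21 := ctK_mul_pos_of_root c e hc hpos hirr ht0 1 rfl hroot
  have h1 : 0 < ctK (fun s : ℕ => if h : s < 3 then c ⟨s, h⟩ ⟨s, h⟩ * t ^ e ⟨s, h⟩ ⟨s, h⟩ else 1)
        (fun s : ℕ => -(if h : s + 1 < 3 then c ⟨s, by omega⟩ ⟨s + 1, h⟩ * t ^ e ⟨s, by omega⟩ ⟨s + 1, h⟩ else 0))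
        (fun s : ℕ => if h : 1 ≤ s ∧ s < 3 then c ⟨s, h.2⟩ ⟨s - 1, by omega⟩ * t ^ e ⟨s, h.2⟩ ⟨s - 1, by omega⟩ else 0) 1 := by
    rw [ctK_one]; exact diagSeq_pos c e hpos ht0 0
  have h2 : 0 < ctK (fun s : ℕ => if h : s < 3 then c ⟨s, h⟩ ⟨s, h⟩ * t ^ e ⟨s, h⟩ ⟨s, h⟩ else 1)
        (fun s : ℕ => -(if h : s + 1 < 3 then c ⟨s, by omega⟩ ⟨s + 1, h⟩ * t ^ e ⟨s, by omega⟩ ⟨s + 1, h⟩ else 0))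
        (fun s : ℕ => if h : 1 ≤ s ∧ s < 3 then c ⟨s, h.2⟩ ⟨s - 1, by omega⟩ * t ^ e ⟨s, h.2⟩ ⟨s - 1, by omega⟩ else 0) 2 := by
    rcases pos_and_pos_or_neg_and_neg_of_mul_pos h21 with ⟨h2, -⟩ | ⟨-, h1'⟩
    · exact h2
    · exact absurd h1 (not_lt.mpr h1'.le)
  intro k hk
  rw [det_leadingBlock_eq_ctK c e hband t hk.le]
  interval_cases k
  · rw [ctK_zero]; exact one_pos
  · exact h1
  · exact h2

/-- **FOUR-BY-FOUR LAW: an irreducible static definite tridiagonal `4 × 4` design has at most FOUR positive determinant zeros.**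
Every positive zero is in the bottom class (`Δ₁, Δ₂, Δ₃ > 0`) or in the top class (`Δ₁ > 0 > Δ₂, Δ₃`), because `d₄ Δ₃ = w₃ Δ₂` at a
zero; the two class laws give `2 + 2`.  (Located sharp value: `3`; not claimed.) [this file] -/
theorem card_posRoots_four_le_four (c : Fin 4 → Fin 4 → ℝ) (e : Fin 4 → Fin 4 → ℕ) (hc : ∀ i j, c i j = c j i)
    (hband : ∀ i j : Fin 4, (i : ℕ) + 1 < j ∨ (j : ℕ) + 1 < i → c i j = 0) (hpos : ∀ i, 0 < c i i)
    (hirr : ∀ (k : ℕ) (hk : k + 1 < 4), c ⟨k, by omega⟩ ⟨k + 1, hk⟩ ≠ 0) :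
    ((Matrix.det (Matrix.of fun i j => C (c i j) * (X : ℝ[X]) ^ e i j)).roots.toFinset.filter
      (fun t : ℝ => 0 < t)).card ≤ 4 := by
  have hB := card_posRoots_bottomClass_le_two c e hc hband hpos
  have hT := card_posRoots_topClass_le_two c e ⟨2, rfl⟩ hc hband hpos
  refine le_trans (Finset.card_le_card ?_) (le_trans (Finset.card_union_le _ _) (add_le_add hB hT))
  intro t ht
  rw [Finset.mem_filter] at ht
  obtain ⟨hmem, ht0⟩ := ht
  rw [Finset.mem_union, Finset.mem_filter, Finset.mem_filter]
  have hmem' := hmem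
  rw [Multiset.mem_toFinset, Polynomial.mem_roots'] at hmem'
  have hroot : ctK (fun s : ℕ => if h : s < 4 then c ⟨s, h⟩ ⟨s, h⟩ * t ^ e ⟨s, h⟩ ⟨s, h⟩ else 1)
        (fun s : ℕ => -(if h : s + 1 < 4 then c ⟨s, by omega⟩ ⟨s + 1, h⟩ * t ^ e ⟨s, by omega⟩ ⟨s + 1, h⟩ else 0))
        (fun s : ℕ => if h : 1 ≤ s ∧ s < 4 then c ⟨s, h.2⟩ ⟨s - 1, by omega⟩ * t ^ e ⟨s, h.2⟩ ⟨s - 1, by omega⟩ else 0) 4 = 0 := by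
    rw [← det_design_eq_ctK c e hband t, ← eval_det_design c e t]; exact hmem'.2
  have h32 := ctK_mul_pos_of_root c e hc hpos hirr ht0 2 rfl hroot
  have h0 : ctK (fun s : ℕ => if h : s < 4 then c ⟨s, h⟩ ⟨s, h⟩ * t ^ e ⟨s, h⟩ ⟨s, h⟩ else 1)
        (fun s : ℕ => -(if h : s + 1 < 4 then c ⟨s, by omega⟩ ⟨s + 1, h⟩ * t ^ e ⟨s, by omega⟩ ⟨s + 1, h⟩ else 0))
        (fun s : ℕ => if h : 1 ≤ s ∧ s < 4 then c ⟨s, h.2⟩ ⟨s - 1, by omega⟩ * t ^ e ⟨s, h.2⟩ ⟨s - 1, by omega⟩ else 0) 0 = 1 := ctK_zero _ _ _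
  have h1 : 0 < ctK (fun s : ℕ => if h : s < 4 then c ⟨s, h⟩ ⟨s, h⟩ * t ^ e ⟨s, h⟩ ⟨s, h⟩ else 1)
        (fun s : ℕ => -(if h : s + 1 < 4 then c ⟨s, by omega⟩ ⟨s + 1, h⟩ * t ^ e ⟨s, by omega⟩ ⟨s + 1, h⟩ else 0))
        (fun s : ℕ => if h : 1 ≤ s ∧ s < 4 then c ⟨s, h.2⟩ ⟨s - 1, by omega⟩ * t ^ e ⟨s, h.2⟩ ⟨s - 1, by omega⟩ else 0) 1 := by
    rw [ctK_one]; exact diagSeq_pos c e hpos ht0 0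
  rcases pos_and_pos_or_neg_and_neg_of_mul_pos h32 with ⟨h3, h2⟩ | ⟨h3, h2⟩
  · left
    refine ⟨hmem, ht0, fun k hk => ?_⟩
    rw [det_leadingBlock_eq_ctK c e hband t hk.le]
    interval_cases k
    · rw [h0]; exact one_pos
    · exact h1
    · exact h2
    · exact h3
  · right
    refine ⟨hmem, ht0, fun k hk => ?_⟩
    rw [det_leadingBlock_eq_ctK c e hband t hk.le]
    interval_cases k
    · rw [h0]; norm_num
    · simpa using h1
    · show 0 < (-1 : ℝ) ^ 1 * _
      rw [pow_one]; linarith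
    · show 0 < (-1 : ℝ) ^ 1 * _
      rw [pow_one]; linarith

end SmallSizes

end Summit.ValiantsHypothesis.ValiantsHypothesis.Theorems.KPlusLogSqLaw.DefiniteInterpolation
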